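import Summits.QuantumAdvantage.AdviceFreeQNC0.CrossFreeWindowBound
import HarnessLib

/-!
# Cell qa-qnc0 (`p = 3`, rung R-lin3 ⊗ R-loc): the cross-free window theorem, FIBRE-DEGREE form

`CrossFreeWindowBound.ringWinU_crossFree_sqrt_le` (qn-prover-3 g3) asks that EVERY selector `y_g` have `𝔽₂`-degree
`≤ D` as a function of all `n` input bits.  Its proof is fibrewise in the outside blocks `(a, b)`: the degree is
consumed only through the restrictions `w ↦ y_g(a ++ w ++ b)` (`hasDeg_inStrategy`, `hasDeg_outParity`).  This file
records the form the proof actually gives: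

* `hasDeg_outParity_fibre` — the outside triple of a window fibre has degree `≤ D` as soon as every selector
  RESTRICTED TO THAT FIBRE has degree `≤ D`;
* **`ringWinU_crossFree_sqrt_le_fibre`** — the cross-free window theorem with the degree hypothesis
  `∀ g a b, HasDeg (w ↦ y_g(a ++ w ++ b)) D` only (degree in the WINDOW bits, uniformly over the outside fibre);
  the selectors may depend on the outside bits arbitrarily.

Consumer: `RingWindowLocalLt3Proof.lean` — bells that are `r`-local inside a long window and otherwise arbitrary
functions of the bits outside it (`BondTwist3.RingWindowLocalLt3` / `RingWindowLocalPolyLt3`, planner qa-qnc0-p1 g20,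
`exp20/Sketch20x.lean` §6/§8) are, on each outside fibre, `(2r+2)`-juntas of the window's walk bits.

The cell's theorem (prover qn-prover-3); not in print.  WHAT THIS IS NOT: no new mechanism — the proof is the g3 proof
with the fibre hypothesis threaded through; crux 22907 untouched; no separation.

## References

* S. Srinivasan, *A robust version of Hegedűs's lemma, with applications*, TheoretiCS 2 (2023),
  Lemma 3.1 [Srinivasan2023] (through `mixedWinU_crossFree_le`).
-/

noncomputable section

namespace Summit.QuantumAdvantage.AdviceFreeQNC0

open Finset
open Literature.Computability.MetaComplexity Literature.Computability.MetaComplexity.Smolensky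

variable {p ℓ q : ℕ}

/-- **Fibre degree of the outside triple**: if every selector restricted to the window fibre over `(a, b)` has
degree `≤ D`, so does the outside triple `P_r` of that fibre (a parity of restricted selectors over a fixed set of
positions). -/
theorem hasDeg_outParity_fibre (c : ℕ) (y : Fin (p + ℓ + q + 1) → (Fin (p + ℓ + q) → Bool) → Bool) {D : ℕ}
    (a : Fin p → Bool) (b : Fin q → Bool) (hdeg : ∀ g, HasDeg (fun w : Fin ℓ → Bool => y g (glue3 a w b)) D)
    (r : ℕ) : HasDeg (outParity y c a b r) D := by
  classical
  have hN : ∀ w, outCount y c a w b r =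
      ((((univ : Finset (Fin (p + ℓ + q + 1))).filter fun g =>
        (g.val < p ∨ p + ℓ < g.val) ∧ gapChar ℓ c a b g.val r % 3 ≠ 0).filter
          fun g => y g (glue3 a w b) = true).card) := by
    intro w
    unfold outCount
    rw [Finset.filter_filter]
    exact congrArg Finset.card (Finset.filter_congr fun g _ => by tauto)
  have heq : outParity y c a b r = fun w => decide
      (((((univ : Finset (Fin (p + ℓ + q + 1))).filter fun g =>
        (g.val < p ∨ p + ℓ < g.val) ∧ gapChar ℓ c a b g.val r % 3 ≠ 0).filter
          fun g => y g (glue3 a w b) = true).card) % 2 = 1) := by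
    funext w
    simp only [outParity, hN w]
  rw [heq]
  exact hasDeg_parity _ (fun g (w : Fin ℓ → Bool) => y g (glue3 a w b)) fun g _ => hdeg g

variable {L H M : ℕ}

/-- **THE CROSS-FREE WINDOW THEOREM, fibre-degree form.**  There are `θ < 1`, `c₁ > 0`, `n₀` such that for all
`p, L, H, M, q` with `L, M ≥ n₀`, every `D ≤ c₁√L`, `D ≤ c₁√M`, every charge and every walk strategy on
`p + (L + H + M) + q` bits such that (i) on EVERY outside fibre `(a, b)` every restricted selector
`w ↦ y_g(a ++ w ++ b)` has `𝔽₂`-degree `≤ D` in the `L + H + M` window bits (the dependence on `a, b` is arbitrary),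
and (ii) for the window `x ++ h ++ z` starting at `p`, the selectors strictly inside the `x`-block do not read `z` and
those strictly inside the `z`-block do not read `x`, the ring game in walk coordinates is won on at most
`θ·2^{p+(L+H+M)+q}` inputs.  (Same `θ, c₁, n₀` as `mixedWinU_crossFree_le`.) [cite: Srinivasan2023, Lemma 3.1] -/
theorem ringWinU_crossFree_sqrt_le_fibre :
    ∃ θ : ℝ, θ < 1 ∧ ∃ c₁ : ℝ, 0 < c₁ ∧ ∃ n₀ : ℕ, ∀ p L H M q : ℕ, n₀ ≤ L → n₀ ≤ M →
      ∀ D : ℕ, (D : ℝ) ≤ c₁ * Real.sqrt L → (D : ℝ) ≤ c₁ * Real.sqrt M →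
      ∀ (c : ℕ) (y : Fin (p + (L + H + M) + q + 1) → (Fin (p + (L + H + M) + q) → Bool) → Bool),
        (∀ (g : Fin (p + (L + H + M) + q + 1)) (a : Fin p → Bool) (b : Fin q → Bool),
          HasDeg (fun w : Fin (L + H + M) → Bool => y g (glue3 a w b)) D) →
        (∀ g : Fin (p + (L + H + M) + q + 1), p < g.val → g.val < p + L →
          ∀ (a : Fin p → Bool) (x : Fin L → Bool) (h : Fin H → Bool) (z z' : Fin M → Bool)
            (b : Fin q → Bool), y g (glue3 a (glue3 x h z) b) = y g (glue3 a (glue3 x h z') b)) →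
        (∀ g : Fin (p + (L + H + M) + q + 1), p + (L + H) < g.val → g.val < p + (L + H + M) →
          ∀ (a : Fin p → Bool) (x x' : Fin L → Bool) (h : Fin H → Bool) (z : Fin M → Bool)
            (b : Fin q → Bool), y g (glue3 a (glue3 x h z) b) = y g (glue3 a (glue3 x' h z) b)) →
        ((univ.filter fun u : Fin (p + (L + H + M) + q) → Bool => ringWinU c y u = true).card : ℝ) ≤
          θ * (2 : ℝ) ^ (p + (L + H + M) + q) := by
  classical
  obtain ⟨η₁, hη₁, c₁, hc₁, n₀, Hmix⟩ := mixedWinU_crossFree_le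
  refine ⟨1 - η₁, by linarith, c₁, hc₁, n₀, ?_⟩
  intro p L H M q hL hM D hDL hDM c y hdeg hX hZ
  rw [card_filter_eq_sum_glue3]
  push_cast
  have hfib : ∀ (a : Fin p → Bool) (b : Fin q → Bool),
      ((univ.filter fun v : Fin (L + H + M) → Bool => ringWinU c y (glue3 a v b) = true).card : ℝ) ≤
        (1 - η₁) * (2 : ℝ) ^ (L + H + M) := by
    intro a b
    have heq : (univ.filter fun v : Fin (L + H + M) → Bool => ringWinU c y (glue3 a v b) = true) =
        univ.filter fun v : Fin (L + H + M) → Bool =>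
          mixedWinU (inCharge c a b) (outParity y c a b) (inStrategy y a b) v = true :=
      Finset.filter_congr fun v _ => by rw [ringWinU_glue3_eq_mixedWinU]
    rw [heq]
    refine Hmix L H M hL hM D hDL hDM (inCharge c a b) (outParity y c a b) (inStrategy y a b)
      (hasDeg_outParity_fibre c y a b (fun g => hdeg g a b)) (fun v => outParity_even c y a b v)
      (fun g' => hdeg _ a b) ?_ ?_
    · intro g' h1 h2 x h z z'
      exact hX ⟨p + g'.val, by omega⟩ (show p < p + g'.val by omega)
        (show p + g'.val < p + L by omega) a x h z z' b
    · intro g' h1 h2 x x' h z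
      exact hZ ⟨p + g'.val, by omega⟩ (show p + (L + H) < p + g'.val by omega)
        (show p + g'.val < p + (L + H + M) by omega) a x x' h z b
  calc ∑ a : Fin p → Bool, ∑ b : Fin q → Bool,
        ((univ.filter fun v : Fin (L + H + M) → Bool => ringWinU c y (glue3 a v b) = true).card : ℝ)
      ≤ ∑ _a : Fin p → Bool, ∑ _b : Fin q → Bool, (1 - η₁) * (2 : ℝ) ^ (L + H + M) :=
        Finset.sum_le_sum fun a _ => Finset.sum_le_sum fun b _ => hfib a b
    _ = (1 - η₁) * (2 : ℝ) ^ (p + (L + H + M) + q) := by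
        simp only [Finset.sum_const, Finset.card_univ, Fintype.card_fun, Fintype.card_bool,
          Fintype.card_fin, nsmul_eq_mul]
        push_cast
        ring

end Summit.QuantumAdvantage.AdviceFreeQNC0

end
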